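import Literature.Analysis.FluidPDE.LerayHopfSpectralMeasurability
import Literature.Analysis.FluidPDE.TimeAverageMeasureBasic
import Literature.Analysis.FluidPDE.NSLerayHopf
import Summits.AnomalousDissipation.AnomalousDissipation.Theorems.WazewskiBlockEnstrophyCapNoLeakageEnergy
import Summits.AnomalousDissipation.AnomalousDissipation.Theses.WazewskiBlock

/-!
# Route WazewskiBlock (AnomalousDissipation) — `EnstrophyCapNoLeakage`

Settles stmt-AnomalousDissipation-1734 (support item `EnstrophyCapNoLeakage` of route
`AnomalousDissipation/WazewskiBlock`): for `ν > 0`, a smooth steady force `f` and a global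
Leray–Hopf solution `u` on `T³` with the pointwise-in-time caps `kineticEnergy (u t) ≤ E` and
`eGradNormSq (u t) ≤ G` for all `t ≥ 0`, the mean work is at most the mean dissipation,
`longTimeAvgSup (t ↦ ∫⟪f, u t⟫) ≤ meanDissipation ν u` ("no Leray–Hopf leakage").

## Proof

The analysis (caps ⇒ `u ∈ L⁴(0,T;L⁴)`; the DATUM-FREE energy equality between positive times
— `Torus.IsLerayHopfOn` does not make `u₀` measurable, so the tree's `lions_energy_equality_Ioc'`
is not applicable as such; the integrated balance `∫₀ᵀ (f,u) ≤ E + ν∫₀ᵀ‖∇u‖²`) is in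
`WazewskiBlockEnstrophyCapNoLeakageEnergy.lean`. Here: the running means satisfy
`timeMean work T ≤ E/T + timeMean (ν‖∇u‖²) T` for `T > 0` (`integral_toReal` identifies the
Bochner time integral of `ν (eGradNormSq (u t)).toReal` with the `lintegral` of the energy
inequality, the integrand being a.e.-measurable and bounded by `νG`), both families of running
means are bounded (`|∫⟪f, u t⟫| ≤ ‖f‖_∞ ½(1+2E)`, `0 ≤ ν‖∇u(t)‖² ≤ νG`), so `limsup` passes to the
inequality and `E/T → 0` (`limsup_le_limsup_of_le_inv_mul_add`).

Sources: Foias–Manley–Rosa–Temam 2001, (12.38)–(12.39) p. 101; Doering–Foias 2002, §2;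
Lions 1960 / Shinbrot 1974 (energy equality in `L⁴L⁴`, in tree).
-/

noncomputable section

open MeasureTheory Filter Topology Set
open scoped InnerProductSpace RealInnerProductSpace ENNReal NNReal

namespace Summit.AnomalousDissipation.AnomalousDissipation.Theorems

set_option linter.dupNamespace false

open Literature.Analysis Literature.Analysis.FluidPDE

/-! ### Cesàro bookkeeping -/

section Cesaro

/-- **`limsup` bookkeeping**: if `a(T) ≤ E/T + b(T)` for `T > 0` and both `a` and `b` are bounded
on `(0, ∞)`, then `limsup_{T→∞} a ≤ limsup_{T→∞} b` (`E/T → 0`; Mathlib's `limsup_le_limsup` and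
`limsup_add_le`, the bounds making every `limsup` honest). -/
theorem limsup_le_limsup_of_le_inv_mul_add {a b : ℝ → ℝ} {E A B : ℝ}
    (hab : ∀ T, 0 < T → a T ≤ E * T⁻¹ + b T) (ha : ∀ T, 0 < T → |a T| ≤ A)
    (hb : ∀ T, 0 < T → |b T| ≤ B) :
    limsup a atTop ≤ limsup b atTop := by
  -- bounds
  have hE : ∀ T : ℝ, 1 ≤ T → |E * T⁻¹| ≤ |E| := fun T hT => by
    rw [abs_mul]
    refine mul_le_of_le_one_right (abs_nonneg E) ?_
    rw [abs_inv]
    exact inv_le_one_of_one_le₀ (hT.trans (le_abs_self T))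
  have hEb : IsBoundedUnder (· ≤ ·) atTop (fun T : ℝ => E * T⁻¹) :=
    isBoundedUnder_of_eventually_le ((eventually_ge_atTop (1 : ℝ)).mono fun T hT => (abs_le.1 (hE T hT)).2)
  have hEb' : IsBoundedUnder (· ≥ ·) atTop (fun T : ℝ => E * T⁻¹) :=
    isBoundedUnder_of_eventually_ge ((eventually_ge_atTop (1 : ℝ)).mono fun T hT => (abs_le.1 (hE T hT)).1)
  have hbb : IsBoundedUnder (· ≤ ·) atTop b :=
    isBoundedUnder_of_eventually_le ((eventually_gt_atTop (0 : ℝ)).mono fun T hT => (abs_le.1 (hb T hT)).2)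
  have hbc : IsCoboundedUnder (· ≤ ·) atTop b :=
    (isBoundedUnder_of_eventually_ge
      ((eventually_gt_atTop (0 : ℝ)).mono fun T hT => (abs_le.1 (hb T hT)).1)).isCoboundedUnder_le
  have hac : IsCoboundedUnder (· ≤ ·) atTop a :=
    (isBoundedUnder_of_eventually_ge
      ((eventually_gt_atTop (0 : ℝ)).mono fun T hT => (abs_le.1 (ha T hT)).1)).isCoboundedUnder_le
  have hsum_b : IsBoundedUnder (· ≤ ·) atTop ((fun T : ℝ => E * T⁻¹) + b) := by
    refine isBoundedUnder_of_eventually_le (a := |E| + B) ?_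
    filter_upwards [eventually_ge_atTop (1 : ℝ)] with T hT
    exact add_le_add ((abs_le.1 (hE T hT)).2) ((abs_le.1 (hb T (by linarith))).2)
  -- the comparison
  have h1 : limsup a atTop ≤ limsup ((fun T : ℝ => E * T⁻¹) + b) atTop := by
    refine limsup_le_limsup ?_ hac hsum_b
    filter_upwards [eventually_gt_atTop (0 : ℝ)] with T hT
    exact hab T hT
  have h2 : limsup ((fun T : ℝ => E * T⁻¹) + b) atTop ≤
      limsup (fun T : ℝ => E * T⁻¹) atTop + limsup b atTop :=
    limsup_add_le hEb' hEb hbc hbb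
  have h3 : limsup (fun T : ℝ => E * T⁻¹) atTop = 0 := by
    refine Tendsto.limsup_eq ?_
    simpa using tendsto_inv_atTop_zero.const_mul E
  linarith

end Cesaro

/-! ### The item -/

section Main

/-- **Settles stmt-AnomalousDissipation-1734 (`EnstrophyCapNoLeakage`, route WazewskiBlock).**
For `ν > 0`, a smooth steady force `f` and a global Leray–Hopf solution `u` on `T³` with
`kineticEnergy (u t) ≤ E` and `eGradNormSq (u t) ≤ G` for all `t ≥ 0`:
`longTimeAvgSup (t ↦ ∫⟪f, u t⟫) ≤ meanDissipation ν u`. The caps give `u ∈ L⁴(0,T;L⁴)` on every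
`(0, T)` (`memLqLp_four_of_caps`), hence the datum-free energy equality between positive times
(`energy_functional_eq_of_memLqLp_four`, Lions 1960 / Shinbrot 1974) and the integrated balance
`∫₀ᵀ(f,u) ≤ E + ν∫₀ᵀ‖∇u‖²` (`setIntegral_work_le_of_memLqLp_four`); dividing by `T` and taking
`limsup` (`limsup_le_limsup_of_le_inv_mul_add`; both running means are bounded, by
`‖f‖_∞ · ½(1+2E)` and `νG`) gives the claim (Foias–Manley–Rosa–Temam 2001, (12.38)–(12.39);
Doering–Foias 2002, §2). -/
theorem enstrophyCapNoLeakage_proof :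
    Summit.AnomalousDissipation.AnomalousDissipation.Theses.WazewskiBlock.EnstrophyCapNoLeakage := by
  intro ν f u₀ u E G hν hf hLH hcap
  set work : ℝ → ℝ := fun t => ∫ x, ⟪f x, u t x⟫ with hwork
  set diss : ℝ → ℝ := fun t => ν * (FunctionSpaces.Torus.eGradNormSq (u t)).toReal with hdiss
  show limsup (timeMean work) atTop ≤ limsup (timeMean diss) atTop
  -- ### constants and slice bounds on `[0, ∞)`
  obtain ⟨KF, -, hKF⟩ := Torus.exists_nonneg_forall_norm_le_of_continuous hf.continuous
  have hmem : ∀ t : ℝ, 0 ≤ t → MemLp (u t) 2 volume := fun t ht =>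
    (hLH (t + 1) (by linarith)).memLp t ⟨ht, by linarith⟩
  have hwork_bd : ∀ t : ℝ, 0 ≤ t → |work t| ≤ KF * (2⁻¹ * (1 + 2 * E)) := fun t ht =>
    abs_integral_inner_le_of_kineticEnergy_le (hmem t ht) hKF (hcap t ht).1
  have hdiss_bd : ∀ t : ℝ, 0 ≤ t → |diss t| ≤ ν * G := fun t ht => by
    simp only [hdiss]
    rw [abs_of_nonneg (mul_nonneg hν.le ENNReal.toReal_nonneg)]
    refine mul_le_mul_of_nonneg_left ?_ hν.le
    have h := ENNReal.toReal_mono ENNReal.coe_ne_top (hcap t ht).2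
    rwa [ENNReal.coe_toReal] at h
  -- ### the integrated balance on every `(0, T]`
  have hbal : ∀ T : ℝ, 0 < T → ∫ τ in Ioc 0 T, work τ ≤
      E + ν * (∫⁻ τ in Ioo 0 T, FunctionSpaces.Torus.eGradNormSq (u τ)).toReal := fun T hT => by
    have hLT := hLH T hT
    have hu4 : Torus.MemLqLp 4 4 u (Ioo 0 T) :=
      memLqLp_four_of_caps (by norm_num [Fintype.card_fin]) (by norm_num [Fintype.card_fin]) hLT
        fun t ht => hcap t ht.1.le
    have hfm := aestronglyMeasurable_stLift_const hf (volume.restrict (Ioo 0 T ×ˢ univ))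
    have hfL := memLqLp_one_two_const (hf.memLp 2) T
    exact setIntegral_work_le_of_memLqLp_four hν.le hLT hT hu4 hfm hfL (hcap T hT.le).1
      fun τ hτ => hwork_bd τ hτ.1.le
  -- ### in terms of running means
  have hmeans : ∀ T : ℝ, 0 < T → timeMean work T ≤ E * T⁻¹ + timeMean diss T := fun T hT => by
    have hLT := hLH T hT
    have hD : ∫ τ in Ioc 0 T, diss τ = ν * (∫⁻ τ in Ioo 0 T, FunctionSpaces.Torus.eGradNormSq (u τ)).toReal := by
      simp only [hdiss]
      rw [integral_const_mul, integral_Ioc_eq_integral_Ioo, integral_toReal hLT.aemeasurable_eGradNormSq]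
      filter_upwards [ae_restrict_mem measurableSet_Ioo] with τ hτ
      exact (hcap τ hτ.1.le).2.trans_lt ENNReal.coe_lt_top
    unfold timeMean
    rw [intervalIntegral.integral_of_le hT.le, intervalIntegral.integral_of_le hT.le, hD]
    calc T⁻¹ * ∫ τ in Ioc 0 T, work τ
        ≤ T⁻¹ * (E + ν * (∫⁻ τ in Ioo 0 T, FunctionSpaces.Torus.eGradNormSq (u τ)).toReal) :=
          mul_le_mul_of_nonneg_left (hbal T hT) (inv_nonneg.2 hT.le)
      _ = E * T⁻¹ + T⁻¹ * (ν * (∫⁻ τ in Ioo 0 T, FunctionSpaces.Torus.eGradNormSq (u τ)).toReal) := by ring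
  -- ### `limsup`
  exact limsup_le_limsup_of_le_inv_mul_add hmeans
    (fun T hT => abs_timeMean_le hT fun t ht _ => hwork_bd t ht.le)
    (fun T hT => abs_timeMean_le hT fun t ht _ => hdiss_bd t ht.le)

end Main

end Summit.AnomalousDissipation.AnomalousDissipation.Theorems
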